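/-
Origin: expansion seat `planner-pub-hodgecm-pohl-g13-0`, handover #6 2026-08-18T13:51:23Z (md5 165456301cc2608ae14f9531057a1d4a, 326 l.; RUN 30 additive leaf; lands AFTER my #5 GaloisSpanBound (a6e9838a); rewrite import Pohl13.GaloisSpanBound -> HodgeCM.Proofs.Pohlmann.GaloisSpanBound x1) (`HOME/pub-hodgecm-pohl-g13/lean/Pohl13/GaloisSpanSubfield.lean`, md5 16545630, 326 lines);
landed by the gen-8 packager in gate run 30 as `HodgeCM/Proofs/Pohlmann/GaloisSpanSubfield.lean` (import ^import Pohl13\.GaloisSpanBound[ \t]*$→import HodgeCM.Proofs.Pohlmann.GaloisSpanBound ×1).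
-/
/-
Copyright: pub-hodgecm formalisation cell (harness21, 2026). New file (not vendored).
Origin: HOME/pub-hodgecm-pohl-g13/lean/Pohl13/GaloisSpanSubfield.lean — session planner-pub-hodgecm-pohl-g13-0 (unit pub-hodgecm-pohl-g13),
EXPANSION part (b) `PohlmannSpan`, generation 13, file 6.  Intended final place: `HodgeCM/Proofs/Pohlmann/GaloisSpanSubfield.lean`
(module `HodgeCM.Proofs.Pohlmann.GaloisSpanSubfield`).  ADDITIVE leaf.  WIP import `Pohl13.GaloisSpanBound`
= this seat's file 5 (rewrite to `import HodgeCM.Proofs.Pohlmann.GaloisSpanBound` on landing).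
-/
import Summits.HodgeConjecture.HodgeCM.Proofs.Pohlmann.GaloisSpanBound

/-!
# A proper CM subfield forces the naive Pohlmann span to FAIL (irreducibility criterion)

Representation-theoretic form of the Galois span condition `LIN(F)` (`NonGalois.GalSpanCondition`).  Let
`V(F) ⊆ ℚ^{Hom(F,ℂ)}` be the space of ODD functions (`f (s̄) = -f s`); `G = Gal(E^c/ℚ)` acts on it by
`f ↦ f ∘ σ`, and the anti-symmetrised indicator `a_σ` (`NonGalois.antiInd (galF n σ)`) is, on `V(F)`, the matrix
of that action: the operator `T_h f (s) = ∑ₓ h (s, x) f x` (`NonGalois.oddOp h`) satisfies `T_{a_σ} f = 2 • (f ∘ σ)`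
(`oddOp_antiInd`) and `T_{e_{s₀,x₀}} f = (2 f x₀) • sgnAt s₀` (`oddOp_elemAnti`).

* `NonGalois.eq_oddSpace_of_antiSpace_le` — **irreducibility criterion**: if the whole anti-space lies in
  `span_ℚ {a_σ}` (which is `LIN(F)` when `Aut(F/ℚ) = {1, c}`, file 2), then `V(F)` has NO proper non-zero
  `G`-stable subspace.  (pohl-g12's stable-type obstruction is the case of a stable LINE.)
* `NonGalois.pullOdd i` — for a ring map `i : k →+* F` from a totally complex number field, the odd functions
  pulled back along restriction `s ↦ s ∘ i` form a `G`-stable subspace of `V(F)` (`pullOdd_stable`), non-zero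
  (`pullOdd_ne_bot`), and PROPER as soon as `[k:ℚ] < [F:ℚ]` (`pullOdd_ne_oddSpace`).
* `NonGalois.not_antiSpace_le_galAntiSpan_of_subfield`, **`NonGalois.not_galSpanCondition_of_subfield
  (hA : AutPair F) (i : k →+* F) (hlt : finrank ℚ k < finrank ℚ F) (n) : ¬ GalSpanCondition F n`** —
  a CM field with `Aut(F/ℚ) = {1, c}` containing a PROPER totally complex subfield violates `LIN`;
  `NonGalois.not_galSpanCondition_of_subfield_of_not_isGalois` — the degree-`2q` form (`AutPair` automatic, file 5).
* `Universe.not_forall_naivePohlmannSpanAt_of_subfield` — hence the naive (old-index-set) Pohlmann span fails for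
  some family of CM types of such a field (file 1's equivalence).

Nothing is posited; nothing is cited.
-/

noncomputable section

open scoped TensorProduct NumberField BigOperators
open NumberField NumberField.ComplexEmbedding

attribute [local instance] Classical.propDecidable

namespace HodgeCM

open Literature.AlgebraicGeometry.Motives (CMType HodgeStructure)
open HodgeCM.Pohlmann HodgeCM.GaoUllmo HodgeCM.CMTypeOps

namespace NonGalois

/-! ### Odd functions and the operators `T_h` -/

section Odd

variable (F : Type) [Field F]

/-- The space `V(F)` of odd functions on `Hom(F, ℂ)`: `f (s̄) = -f s`. -/
def oddSpace : Submodule ℚ ((F →+* ℂ) → ℚ) where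
  carrier := {f | ∀ s, f (conjugate s) = -f s}
  add_mem' {f g} hf hg s := by rw [Pi.add_apply, Pi.add_apply, hf s, hg s, neg_add]
  zero_mem' s := by rw [Pi.zero_apply, Pi.zero_apply, neg_zero]
  smul_mem' c f hf s := by rw [Pi.smul_apply, Pi.smul_apply, hf s, smul_neg]

variable {F}

/-- (Ported verbatim from the HodgeCMPerL package; no docstring in the source.) -/
theorem mem_oddSpace {f : (F →+* ℂ) → ℚ} : f ∈ oddSpace F ↔ ∀ s, f (conjugate s) = -f s := Iff.rfl

/-- (Ported verbatim from the HodgeCMPerL package; no docstring in the source.) -/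
theorem sgnAt_mem_oddSpace (y : F →+* ℂ) : sgnAt y ∈ oddSpace F := fun s => sgnAt_conjugate_right y s

/-- (Ported verbatim from the HodgeCMPerL package; no docstring in the source.) -/
theorem sgnAt_comm (y x : F →+* ℂ) : sgnAt y x = sgnAt x y := by
  have h : (conjugate y = x) ↔ (conjugate x = y) :=
    ⟨fun h => by rw [← h, involutive_conjugate], fun h => by rw [← h, involutive_conjugate]⟩
  simp only [sgnAt, h, @eq_comm _ y x]

variable [NumberField F]

/-- The operator `T_h f (s) = ∑ₓ h (s, x) · f x` attached to a two-variable function `h`. -/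
def oddOp (h : (F →+* ℂ) × (F →+* ℂ) → ℚ) (f : (F →+* ℂ) → ℚ) : (F →+* ℂ) → ℚ :=
  fun s => ∑ x, h (s, x) * f x

/-- (Ported verbatim from the HodgeCMPerL package; no docstring in the source.) -/
theorem oddOp_apply (h : (F →+* ℂ) × (F →+* ℂ) → ℚ) (f : (F →+* ℂ) → ℚ) (s : F →+* ℂ) :
    oddOp h f s = ∑ x, h (s, x) * f x := rfl

/-- (Ported verbatim from the HodgeCMPerL package; no docstring in the source.) -/
theorem oddOp_zero (f : (F →+* ℂ) → ℚ) : oddOp 0 f = 0 := by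
  funext s
  simp only [oddOp_apply, Pi.zero_apply, zero_mul, Finset.sum_const_zero]

/-- (Ported verbatim from the HodgeCMPerL package; no docstring in the source.) -/
theorem oddOp_add (h h' : (F →+* ℂ) × (F →+* ℂ) → ℚ) (f : (F →+* ℂ) → ℚ) : oddOp (h + h') f = oddOp h f + oddOp h' f := by
  funext s
  simp only [oddOp_apply, Pi.add_apply, add_mul, Finset.sum_add_distrib]

/-- (Ported verbatim from the HodgeCMPerL package; no docstring in the source.) -/
theorem oddOp_smul (c : ℚ) (h : (F →+* ℂ) × (F →+* ℂ) → ℚ) (f : (F →+* ℂ) → ℚ) : oddOp (c • h) f = c • oddOp h f := by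
  funext s
  simp only [oddOp_apply, Pi.smul_apply, smul_eq_mul, mul_assoc, Finset.mul_sum]

/-- `∑ₓ sgnAt y x · f x = 2 f y` for an odd `f`. -/
theorem sum_sgnAt_mul {f : (F →+* ℂ) → ℚ} (hf : f ∈ oddSpace F) (y : F →+* ℂ) : ∑ x, sgnAt y x * f x = 2 * f y := by
  simp only [sgnAt, sub_mul, ite_mul, one_mul, zero_mul, Finset.sum_sub_distrib, Finset.sum_ite_eq, Finset.mem_univ,
    if_true]
  rw [hf y]
  ring

/-- `T_{a_g} f = 2 • (f ∘ g)` on odd functions. -/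
theorem oddOp_antiInd (g : (F →+* ℂ) → (F →+* ℂ)) {f : (F →+* ℂ) → ℚ} (hf : f ∈ oddSpace F) :
    oddOp (antiInd g) f = (2 : ℚ) • (f ∘ g) := by
  funext s
  rw [oddOp_apply, Pi.smul_apply, Function.comp_apply, smul_eq_mul]
  simp only [antiInd_eq_sgnAt]
  exact sum_sgnAt_mul hf (g s)

/-- `T_{e_{s₀,x₀}} f = (2 f x₀) • sgnAt s₀` on odd functions. -/
theorem oddOp_elemAnti (s₀ x₀ : F →+* ℂ) {f : (F →+* ℂ) → ℚ} (hf : f ∈ oddSpace F) :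
    oddOp (elemAnti s₀ x₀) f = (2 * f x₀) • sgnAt s₀ := by
  funext s
  rw [oddOp_apply, Pi.smul_apply, smul_eq_mul]
  simp only [elemAnti_apply, mul_assoc]
  rw [← Finset.mul_sum, sum_sgnAt_mul hf x₀]
  ring

/-- An odd function is the combination `2 • f = ∑ₓ f x • sgnAt x`. -/
theorem two_smul_eq_sum_sgnAt {f : (F →+* ℂ) → ℚ} (hf : f ∈ oddSpace F) : (2 : ℚ) • f = ∑ x, f x • sgnAt x := by
  funext s
  rw [Pi.smul_apply, Finset.sum_apply, smul_eq_mul]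
  simp only [Pi.smul_apply, smul_eq_mul]
  have h : ∀ x, f x * sgnAt x s = sgnAt s x * f x := fun x => by rw [sgnAt_comm, mul_comm]
  simp only [h]
  rw [sum_sgnAt_mul hf s]

variable {n : ℕ}

/-- A subspace of odd functions stable under `G = Gal(E^c/ℚ)` is stable under `T_h` for every `h ∈ span_ℚ {a_σ}`. -/
theorem oddOp_mem_of_mem_galAntiSpan (W : Submodule ℚ ((F →+* ℂ) → ℚ)) (hW : W ≤ oddSpace F)
    (hstab : ∀ σ : galoisClosure (Fin (n + 1) → F) ≃ₐ[ℚ] galoisClosure (Fin (n + 1) → F), ∀ f ∈ W, f ∘ galF n σ ∈ W)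
    {h : (F →+* ℂ) × (F →+* ℂ) → ℚ} (hh : h ∈ galAntiSpan F n) {f : (F →+* ℂ) → ℚ} (hf : f ∈ W) : oddOp h f ∈ W := by
  induction hh using Submodule.span_induction with
  | mem h hh =>
    obtain ⟨σ, rfl⟩ := hh
    rw [oddOp_antiInd (galF n σ) (hW hf)]
    exact W.smul_mem 2 (hstab σ f hf)
  | zero => rw [oddOp_zero]; exact W.zero_mem
  | add h h' _ _ ih ih' => rw [oddOp_add]; exact W.add_mem ih ih'
  | smul c h _ ih => rw [oddOp_smul]; exact W.smul_mem c ih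

/-- **Irreducibility criterion.** If the anti-space lies in `span_ℚ {a_σ : σ ∈ Gal(E^c/ℚ)}` (= `LIN(F)` when
`Aut(F/ℚ) = {1, c}`, `galSpanCondition_iff_antiSpace_le`), then the odd functions `V(F)` have no proper non-zero
`G`-stable subspace. -/
theorem eq_oddSpace_of_antiSpace_le [IsTotallyComplex F] (hle : antiSpace F ≤ galAntiSpan F n)
    (W : Submodule ℚ ((F →+* ℂ) → ℚ)) (hW : W ≤ oddSpace F)
    (hstab : ∀ σ : galoisClosure (Fin (n + 1) → F) ≃ₐ[ℚ] galoisClosure (Fin (n + 1) → F), ∀ f ∈ W, f ∘ galF n σ ∈ W)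
    (hne : W ≠ ⊥) : W = oddSpace F := by
  refine le_antisymm hW ?_
  obtain ⟨f, hfW, hf0⟩ := (Submodule.ne_bot_iff W).mp hne
  obtain ⟨x₀, hx₀⟩ : ∃ x₀, f x₀ ≠ 0 := Function.ne_iff.mp hf0
  -- every `sgnAt s₀` lies in `W`
  have hsgn : ∀ s₀, sgnAt s₀ ∈ W := fun s₀ => by
    have h1 : oddOp (elemAnti s₀ x₀) f ∈ W :=
      oddOp_mem_of_mem_galAntiSpan W hW hstab (hle (elemAnti_mem_antiSpace s₀ x₀)) hfW
    rw [oddOp_elemAnti s₀ x₀ (hW hfW)] at h1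
    have h2 : (2 * f x₀)⁻¹ • ((2 * f x₀) • sgnAt s₀) ∈ W := W.smul_mem _ h1
    rwa [smul_smul, inv_mul_cancel₀ (mul_ne_zero two_ne_zero hx₀), one_smul] at h2
  intro g hg
  have h3 : (2 : ℚ)⁻¹ • ((2 : ℚ) • g) ∈ W := by
    rw [two_smul_eq_sum_sgnAt hg]
    exact W.smul_mem _ (W.sum_mem fun x _ => W.smul_mem _ (hsgn x))
  rwa [smul_smul, inv_mul_cancel₀ (two_ne_zero : (2 : ℚ) ≠ 0), one_smul] at h3

end Odd

/-! ### Pulling odd functions back from a subfield -/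

section Subfield

variable {k F : Type} [Field k] [Field F]

/-- Restriction of complex embeddings along `i : k →+* F`. -/
def resEmb (i : k →+* F) (s : F →+* ℂ) : k →+* ℂ := s.comp i

/-- (Ported verbatim from the HodgeCMPerL package; no docstring in the source.) -/
theorem resEmb_apply (i : k →+* F) (s : F →+* ℂ) (b : k) : resEmb i s b = s (i b) := rfl

/-- (Ported verbatim from the HodgeCMPerL package; no docstring in the source.) -/
theorem resEmb_conjugate (i : k →+* F) (s : F →+* ℂ) : resEmb i (conjugate s) = conjugate (resEmb i s) := rfl

/-- The odd functions on `Hom(k, ℂ)` pulled back to `Hom(F, ℂ)` along restriction. -/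
def pullOdd (i : k →+* F) : Submodule ℚ ((F →+* ℂ) → ℚ) :=
  (oddSpace k).map (LinearMap.funLeft ℚ ℚ (resEmb i))

/-- (Ported verbatim from the HodgeCMPerL package; no docstring in the source.) -/
theorem mem_pullOdd (i : k →+* F) {g : (F →+* ℂ) → ℚ} : g ∈ pullOdd i ↔ ∃ f ∈ oddSpace k, f ∘ resEmb i = g := by
  simp only [pullOdd, Submodule.mem_map]
  rfl

/-- (Ported verbatim from the HodgeCMPerL package; no docstring in the source.) -/
theorem pullOdd_le_oddSpace (i : k →+* F) : pullOdd i ≤ oddSpace F := by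
  intro g hg
  obtain ⟨f, hf, rfl⟩ := (mem_pullOdd i).mp hg
  intro s
  rw [Function.comp_apply, Function.comp_apply, resEmb_conjugate, hf]

variable [NumberField F] {n : ℕ}

/-- `(σ·s) ∘ i` depends only on `s ∘ i`. -/
theorem resEmb_galF_eq (i : k →+* F) (σ : galoisClosure (Fin (n + 1) → F) ≃ₐ[ℚ] galoisClosure (Fin (n + 1) → F))
    {s s' : F →+* ℂ} (h : resEmb i s = resEmb i s') : resEmb i (galF n σ s) = resEmb i (galF n σ s') := by
  refine RingHom.ext fun b => ?_
  have hb : s (i b) = s' (i b) := by rw [← resEmb_apply i s b, ← resEmb_apply i s' b, h]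
  rw [resEmb_apply, resEmb_apply, galF_apply_eq_coe, galF_apply_eq_coe]
  have hsub : (⟨s (i b), apply_mem_galoisClosure (n := n) s (i b)⟩ : galoisClosure (Fin (n + 1) → F)) =
      ⟨s' (i b), apply_mem_galoisClosure (n := n) s' (i b)⟩ := Subtype.ext hb
  rw [hsub]

variable [NumberField k]

/-- Every complex embedding of `k` extends along `i` to one of `F` (`ℂ` is algebraically closed, `F/k` algebraic). -/
theorem resEmb_surjective (i : k →+* F) : Function.Surjective (resEmb i) := fun t => by
  letI : Algebra k F := i.toAlgebra
  letI : Algebra k ℂ := t.toAlgebra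
  haveI : IsScalarTower ℚ k F := IsScalarTower.of_algebraMap_eq' (Subsingleton.elim _ _)
  haveI : Algebra.IsAlgebraic k F := Algebra.IsAlgebraic.tower_top (K := ℚ) k
  let s : F →ₐ[k] ℂ := IsAlgClosed.lift
  exact ⟨s.toRingHom, RingHom.ext fun b => s.commutes b⟩

/-- The induced action of `σ ∈ Gal(E^c/ℚ)` on `Hom(k, ℂ)`: `t ↦ (σ·s) ∘ i` for any extension `s` of `t`. -/
def galK (i : k →+* F) (n : ℕ) (σ : galoisClosure (Fin (n + 1) → F) ≃ₐ[ℚ] galoisClosure (Fin (n + 1) → F))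
    (t : k →+* ℂ) : k →+* ℂ :=
  resEmb i (galF n σ (Function.surjInv (resEmb_surjective i) t))

/-- (Ported verbatim from the HodgeCMPerL package; no docstring in the source.) -/
theorem galK_resEmb (i : k →+* F) (σ : galoisClosure (Fin (n + 1) → F) ≃ₐ[ℚ] galoisClosure (Fin (n + 1) → F))
    (s : F →+* ℂ) : galK i n σ (resEmb i s) = resEmb i (galF n σ s) :=
  resEmb_galF_eq i σ (Function.surjInv_eq (resEmb_surjective i) (resEmb i s))

/-- (Ported verbatim from the HodgeCMPerL package; no docstring in the source.) -/
theorem galK_conjugate [IsCMField F] (i : k →+* F)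
    (σ : galoisClosure (Fin (n + 1) → F) ≃ₐ[ℚ] galoisClosure (Fin (n + 1) → F)) (t : k →+* ℂ) :
    galK i n σ (conjugate t) = conjugate (galK i n σ t) := by
  obtain ⟨s, rfl⟩ := resEmb_surjective i t
  rw [← resEmb_conjugate, galK_resEmb, galK_resEmb, isBarCommuting_galF σ s, resEmb_conjugate]

/-- (Ported verbatim from the HodgeCMPerL package; no docstring in the source.) -/
theorem pullOdd_stable [IsCMField F] (i : k →+* F) (σ : galoisClosure (Fin (n + 1) → F) ≃ₐ[ℚ] galoisClosure (Fin (n + 1) → F))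
    (g : (F →+* ℂ) → ℚ) (hg : g ∈ pullOdd i) : g ∘ galF n σ ∈ pullOdd i := by
  obtain ⟨f, hf, rfl⟩ := (mem_pullOdd i).mp hg
  refine (mem_pullOdd i).mpr ⟨f ∘ galK i n σ, fun t => ?_, funext fun s => ?_⟩
  · rw [Function.comp_apply, Function.comp_apply, galK_conjugate, hf]
  · simp only [Function.comp_apply, galK_resEmb]

/-- (Ported verbatim from the HodgeCMPerL package; no docstring in the source.) -/
theorem pullOdd_ne_bot [IsTotallyComplex k] (i : k →+* F) : pullOdd i ≠ ⊥ := by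
  obtain ⟨t₀⟩ : Nonempty (k →+* ℂ) := inferInstance
  rw [Submodule.ne_bot_iff]
  refine ⟨sgnAt t₀ ∘ resEmb i, (mem_pullOdd i).mpr ⟨sgnAt t₀, sgnAt_mem_oddSpace t₀, rfl⟩, fun h => ?_⟩
  obtain ⟨s₀, hs₀⟩ := resEmb_surjective i t₀
  have h1 := congr_fun h s₀
  rw [Function.comp_apply, hs₀, sgnAt_self, Pi.zero_apply] at h1
  exact one_ne_zero h1

/-- If `[k:ℚ] < [F:ℚ]`, some `sgnAt s` is odd but not pulled back from `k`: the pulled-back space is PROPER. -/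
theorem pullOdd_ne_oddSpace [IsTotallyComplex k] [IsTotallyComplex F] (i : k →+* F)
    (hlt : Module.finrank ℚ k < Module.finrank ℚ F) : pullOdd i ≠ oddSpace F := by
  intro h
  have hcard : Fintype.card (k →+* ℂ) < Fintype.card (F →+* ℂ) := by
    rwa [NumberField.Embeddings.card, NumberField.Embeddings.card]
  obtain ⟨s, s', hne, hss'⟩ := Fintype.exists_ne_map_eq_of_card_lt (resEmb i) hcard
  have hs : sgnAt s ∈ pullOdd i := by rw [h]; exact sgnAt_mem_oddSpace s
  obtain ⟨f, -, hf⟩ := (mem_pullOdd i).mp hs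
  have h1 : sgnAt s s = sgnAt s s' := by
    rw [← hf, Function.comp_apply, Function.comp_apply, hss']
  have h2 : conjugate s ≠ s' := fun h' => by
    have h3 : resEmb i (conjugate s) = resEmb i s := by rw [h', ← hss']
    rw [resEmb_conjugate] at h3
    exact conjugate_ne (resEmb i s) h3
  rw [sgnAt_self, sgnAt_of_ne_of_ne hne h2] at h1
  exact one_ne_zero h1

/-- **Subfield obstruction.** A totally complex number field `F` admitting a ring map from a totally complex
number field `k` of smaller degree (a proper CM-type subfield) has a proper non-zero `G`-stable subspace of odd
functions, so the anti-space is NOT contained in `span_ℚ {a_σ}`. -/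
theorem not_antiSpace_le_galAntiSpan_of_subfield [IsTotallyComplex k] [IsCMField F] (i : k →+* F)
    (hlt : Module.finrank ℚ k < Module.finrank ℚ F) (n : ℕ) : ¬ (antiSpace F ≤ galAntiSpan F n) := fun hle =>
  pullOdd_ne_oddSpace i hlt
    (eq_oddSpace_of_antiSpace_le hle (pullOdd i) (pullOdd_le_oddSpace i) (pullOdd_stable i) (pullOdd_ne_bot i))

/-- **Theorem.** A CM field with `Aut(F/ℚ) = {1, c}` containing a proper totally complex subfield violates the
Galois span condition `LIN(F)` (at every level). -/
theorem not_galSpanCondition_of_subfield [IsTotallyComplex k] [IsCMField F] (hA : AutPair F) (i : k →+* F)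
    (hlt : Module.finrank ℚ k < Module.finrank ℚ F) (n : ℕ) : ¬ GalSpanCondition F n := by
  rw [galSpanCondition_iff_antiSpace_le hA]
  exact not_antiSpace_le_galAntiSpan_of_subfield i hlt n

/-- (Ported verbatim from the HodgeCMPerL package; no docstring in the source.) -/
theorem not_forall_indexSetsAgree_of_subfield [IsTotallyComplex k] [IsCMField F] (hA : AutPair F) (i : k →+* F)
    (hlt : Module.finrank ℚ k < Module.finrank ℚ F) :
    ¬ ∀ (m : ℕ) (Θ : Fin (m + 1) → CMType F) (p : ℕ), IndexSetsAgree Θ p := by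
  rw [← galSpanCondition_iff_indexSetsAgree 0]
  exact not_galSpanCondition_of_subfield hA i hlt 0

/-- Degree `2q` (`q` prime), non-Galois: `Aut(F/ℚ) = {1, c}` is automatic (file 5), so a proper totally complex
subfield alone refutes `LIN(F)`.  (Sextic case: an imaginary quadratic subfield — the fields `F = F₀·k`.) -/
theorem not_galSpanCondition_of_subfield_of_not_isGalois [IsTotallyComplex k] [IsCMField F] {q : ℕ} (hq : q.Prime)
    (hdeg : Module.finrank ℚ F = 2 * q) (hF : ¬ IsGalois ℚ F) (i : k →+* F) (hlt : Module.finrank ℚ k < Module.finrank ℚ F)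
    (n : ℕ) : ¬ GalSpanCondition F n :=
  not_galSpanCondition_of_subfield (autPair_of_not_isGalois hq hdeg hF) i hlt n

end Subfield

end NonGalois

/-! ### Consequence for the naive Pohlmann span -/

namespace Universe

open NonGalois

variable {U : Universe}

/-- **A proper totally complex subfield refutes the naive Pohlmann span.**  For a CM field `F` with
`Aut(F/ℚ) = {1, c}` and a ring map `i : k →+* F` from a totally complex number field with `[k:ℚ] < [F:ℚ]`,
the naive (old-index-set) span statement fails for some family of CM types of `F`. -/
theorem not_forall_naivePohlmannSpanAt_of_subfield (M : U.ModelAxioms) (hN1 : U.Fact_cupExterior)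
    (hN2 : U.Fact_cup_hodge) (hN3 : U.Fact_pull_H0) (F : CMField) (hA : AutPair F) {k : Type} [Field k] [NumberField k]
    [IsTotallyComplex k] (i : k →+* (F : Type)) (hlt : Module.finrank ℚ k < Module.finrank ℚ F) :
    ¬ ∀ (n : ℕ) (Θ : Fin (n + 1) → CMType F) (p : ℕ), U.NaivePohlmannSpanAt F Θ p := by
  rw [forall_naivePohlmannSpanAt_iff_galSpanCondition M hN1 hN2 hN3]
  exact not_galSpanCondition_of_subfield hA i hlt 0

/-- Degree-`2q` form: a non-Galois CM field of degree `2q` (`q` prime) with a proper totally complex subfield. -/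
theorem not_forall_naivePohlmannSpanAt_of_subfield_of_not_isGalois (M : U.ModelAxioms) (hN1 : U.Fact_cupExterior)
    (hN2 : U.Fact_cup_hodge) (hN3 : U.Fact_pull_H0) (F : CMField) {q : ℕ} (hq : q.Prime)
    (hdeg : Module.finrank ℚ F = 2 * q) (hF : ¬ IsGalois ℚ (F : Type)) {k : Type} [Field k] [NumberField k]
    [IsTotallyComplex k] (i : k →+* (F : Type)) (hlt : Module.finrank ℚ k < Module.finrank ℚ F) :
    ¬ ∀ (n : ℕ) (Θ : Fin (n + 1) → CMType F) (p : ℕ), U.NaivePohlmannSpanAt F Θ p :=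
  not_forall_naivePohlmannSpanAt_of_subfield M hN1 hN2 hN3 F (autPair_of_not_isGalois hq hdeg hF) i hlt

end Universe

end HodgeCM
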